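import Summits.ABC.StewartYu.PadicG3ParVB
import HarnessLib

/-!
# The `p`-adic Gen-3 parameter record — part VO: EXACT-FORM level-0 orders (both branches)

Support file (plain theorems over `PadicG3Par`; no definitions, no named facts), cell `abc-stewartyu`, seat p1-g8
(route holder's ask STATUS 2026-08-27T05:33:25Z: «`MordV_T0_le` is too lossy here — an exact-form `MordV 0 0 ≤ …/(n+2)³ + …`
would be the one helper to land»).  The level-0 START of the frame (`PadicG3RecordR2.siegelCountR₂_of_ineq`, p2) counts
`C(T₀+n−1, n) ≤ (T₀+n−1)ⁿ/n!` restricted multi-orders with `T₀ = TordS Sc 0 0 = Mord 0 0 + Ŝ(n+1) + n`; every analytic family has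
`t₀ ≤ TordS`.  The landed order bounds (`MordV_zero_zero_add_le : MordV 0 0 + n ≤ 17(n+1)LgV`, `MordV_T0_le : … ≤ (69/4)(n+1)LgV`,
v1 `Mord_zero_zero_le' : Mord 0 0 ≤ (448/27)(n+1)L`) round `(n+2)³ ≥ 27`; at the `/4` box the Siegel count sits on the design edge
(`C_b = 32e`, Stirling), so the `(n+2)³` must be kept.  This file:

* `m = 0` (V family): `MordV_zero_zero_exact_le : MordV 0 0 ≤ 16(n+1)LgV/(n+2)³ + (n+1)(16 LgV + ŜG + 1)` (real form of the landed
  `MordV_zero_zero_le`), `T0V_exact_le` (adds the transition reserve `(n+1)(ŜG+1) + n ≥ Ŝ(n+1)+n+(n−1)`), and the relative form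
  `T0V_le_mul : MordV 0 0 + (n+1)(ŜG+1) + n ≤ 16(n+1)LgV·(1 + 1/(n+2)³ + 1/32)` (from `4(ŜG+2) ≤ LgV`);
* `m ≥ 1` (v1 family): `Mord_zero_zero_exact : Mord 0 0 = ⌊16(n+1)L/(n+2)³⌋ + 16(n+1)L` is `Mord_zero_zero` (ParB); here the real
  forms `Mord_zero_zero_exact_le`, `T01_exact_le`, and `T01_le_mul : Mord 0 0 + (n+1)(Ŝ+1) + n ≤ 16(n+1)L·(1 + 1/(n+2)³ + 1/2^25)`
  (from `2·2^Ŝ ≤ L`, `Ŝ ≥ 25`: the reserve is `≤ 2^{−25}` of the main term).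

WHAT THIS IS NOT: the Siegel count itself (lp-1's `startCount*`), nor a box ruling.

## References
* [Nesterenko2003] Yu. V. Nesterenko, LNM 1819 (2003) — (3.25), (4.5), (4.6).
-/

noncomputable section

open Finset Real

namespace Summit.ABC.StewartYu

namespace PadicG3Par

variable {n : ℕ} (P : PadicG3Par n)

/-! ### `m = 0`: the V family -/

/-- **`MordV 0 0 ≤ 16(n+1)LgV/(n+2)³ + (n+1)(16 LgV + ŜG + 1)`** (real, `(n+2)³` kept). [cite: Nesterenko2003, (3.25), (4.5)] -/
theorem MordV_zero_zero_exact_le :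
    (P.MordV 0 0 : ℝ) ≤ 16 * (n + 1) * P.LgV / (n + 2) ^ 3 + (n + 1) * (16 * P.LgV + (P.SdG + 1)) := by
  have h := P.MordV_zero_zero_le
  have h1 : ((P.MordV 0 0 : ℕ) : ℝ) ≤ ((P.MV / (n + 2) ^ 3 + (n + 1) * (16 * P.LgV + (P.SdG + 1)) : ℕ) : ℝ) := by
    exact_mod_cast h
  have h2 : ((P.MV / (n + 2) ^ 3 : ℕ) : ℝ) ≤ ((P.MV : ℕ) : ℝ) / (((n + 2) ^ 3 : ℕ) : ℝ) := Nat.cast_div_le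
  push_cast at h1 h2
  rw [P.MV_real] at h2
  linarith

/-- **`T₀`-bound, exact form**: `MordV 0 0 + (n+1)(ŜG+1) + n ≤ 16(n+1)LgV/(n+2)³ + 16(n+1)LgV + (n+1)(2ŜG+2) + n`
(`T₀ = TordS (schedVb b) 0 0 = MordV 0 0 + ŜG(n+1) + n`, and `T₀ + n − 1` is below the left side). [cite: Nesterenko2003, (4.5), (4.6)] -/
theorem T0V_exact_le :
    (P.MordV 0 0 : ℝ) + (n + 1) * (P.SdG + 1) + n ≤
      16 * (n + 1) * P.LgV / (n + 2) ^ 3 + 16 * (n + 1) * P.LgV + (n + 1) * (2 * P.SdG + 2) + n := by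
  have h := P.MordV_zero_zero_exact_le
  linarith

/-- **`T₀`-bound, relative form**: `MordV 0 0 + (n+1)(ŜG+1) + n ≤ 16(n+1)LgV·(1 + 1/(n+2)³ + 1/32)`
(the reserve `(n+1)(2ŜG+2) + n ≤ (n+1)(2ŜG+3) ≤ (n+1)LgV/2` by `4(ŜG+2) ≤ LgV`). [cite: Nesterenko2003, (4.5), (4.6)] -/
theorem T0V_le_mul :
    (P.MordV 0 0 : ℝ) + (n + 1) * (P.SdG + 1) + n ≤ 16 * (n + 1) * P.LgV * (1 + 1 / (n + 2) ^ 3 + 1 / 32) := by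
  have h := P.T0V_exact_le
  have h4 : ((4 * (P.SdG + 2) : ℕ) : ℝ) ≤ P.LgV := by exact_mod_cast P.four_SdG_le_LgV
  push_cast at h4
  have hn : (0 : ℝ) ≤ n := by positivity
  have hprod : ((n : ℝ) + 1) * (4 * (P.SdG + 2)) ≤ ((n : ℝ) + 1) * P.LgV :=
    mul_le_mul_of_nonneg_left h4 (by positivity)
  have e : 16 * (n + 1) * (P.LgV : ℝ) * (1 + 1 / (n + 2) ^ 3 + 1 / 32) =
      16 * (n + 1) * P.LgV / (n + 2) ^ 3 + 16 * (n + 1) * P.LgV + (n + 1) * P.LgV / 2 := by ring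
  rw [e]
  linarith

/-- `T₀ + n − 1 ≤ MordV 0 0 + (n+1)(ŜG+1) + n` in the letters of p2's schedule: `(MordV 0 0 + ŜG(n+1) + n) + n − 1 ≤ …` (ℕ).
[folklore] -/
theorem T0V_add_le : P.MordV 0 0 + P.SdG * (n + 1) + n + n - 1 ≤ P.MordV 0 0 + (n + 1) * (P.SdG + 1) + n := by
  have : P.SdG * (n + 1) + n - 1 ≤ (n + 1) * (P.SdG + 1) := by
    have h : (n + 1) * (P.SdG + 1) = P.SdG * (n + 1) + (n + 1) := by ring
    omega
  omega

/-! ### `m ≥ 1`: the v1 family -/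

/-- **`Mord 0 0 ≤ 16(n+1)L/(n+2)³ + 16(n+1)L`** (real, `(n+2)³` kept; `Mord 0 0 = M/(n+2)³ + M`). [cite: Nesterenko2003, (3.25)] -/
theorem Mord_zero_zero_exact_le : (P.Mord 0 0 : ℝ) ≤ 16 * (n + 1) * P.L / (n + 2) ^ 3 + 16 * (n + 1) * P.L := by
  rw [P.Mord_zero_zero]
  have h2 : ((P.M / (n + 2) ^ 3 : ℕ) : ℝ) ≤ ((P.M : ℕ) : ℝ) / (((n + 2) ^ 3 : ℕ) : ℝ) := Nat.cast_div_le
  push_cast at h2 ⊢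
  rw [P.M_real] at h2 ⊢
  linarith

/-- **`T₀`-bound, exact form (v1)**: `Mord 0 0 + (n+1)(Ŝ+1) + n ≤ 16(n+1)L/(n+2)³ + 16(n+1)L + (n+1)(Ŝ+1) + n`
(`T₀ = TordS (sched1b b) 0 0 = Mord 0 0 + Ŝ(n+1) + n`). [cite: Nesterenko2003, (4.5), (4.6)] -/
theorem T01_exact_le :
    (P.Mord 0 0 : ℝ) + (n + 1) * (P.Sdepth + 1) + n ≤
      16 * (n + 1) * P.L / (n + 2) ^ 3 + 16 * (n + 1) * P.L + (n + 1) * (P.Sdepth + 1) + n := by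
  have h := P.Mord_zero_zero_exact_le
  linarith

/-- `2^21·(Ŝ + 3) ≤ 2·2^Ŝ` for `Ŝ ≥ 25` (ℕ). [folklore] -/
theorem two_pow_21_mul_le {S : ℕ} (hS : 25 ≤ S) : 2 ^ 21 * (S + 3) ≤ 2 * 2 ^ S := by
  induction S, hS using Nat.le_induction with
  | base => norm_num
  | succ k _ ih =>
    have h3 : 2 ^ 21 ≤ 2 * 2 ^ k := by
      calc 2 ^ 21 ≤ 2 ^ 21 * (k + 3) := Nat.le_mul_of_pos_right _ (by omega)
        _ ≤ 2 * 2 ^ k := ih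
    calc 2 ^ 21 * (k + 1 + 3) = 2 ^ 21 * (k + 3) + 2 ^ 21 := by ring
      _ ≤ 2 * 2 ^ k + 2 * 2 ^ k := Nat.add_le_add ih h3
      _ = 2 * 2 ^ (k + 1) := by ring

/-- `2^21·(Ŝ + 3) ≤ L` (v1: `2·2^Ŝ ≤ L`, `Ŝ = n + 24 + log₂ N_q ≥ 25`). [folklore] -/
theorem two_pow_21_mul_Sdepth_le_L : 2 ^ 21 * (P.Sdepth + 3) ≤ P.L := by
  have hS : 25 ≤ P.Sdepth := by have := P.hn; unfold Sdepth; omega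
  exact (two_pow_21_mul_le hS).trans P.two_mul_two_pow_Sdepth_le_L

/-- **`T₀`-bound, relative form (v1)**: `Mord 0 0 + (n+1)(Ŝ+1) + n ≤ 16(n+1)L·(1 + 1/(n+2)³ + 1/2^25)`
(the reserve `(n+1)(Ŝ+1) + n ≤ (n+1)(Ŝ+3) ≤ (n+1)L/2^21 = 16(n+1)L/2^25`). [cite: Nesterenko2003, (4.5), (4.6)] -/
theorem T01_le_mul :
    (P.Mord 0 0 : ℝ) + (n + 1) * (P.Sdepth + 1) + n ≤ 16 * (n + 1) * P.L * (1 + 1 / (n + 2) ^ 3 + 1 / 2 ^ 25) := by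
  have h := P.T01_exact_le
  have h4 : ((2 ^ 21 * (P.Sdepth + 3) : ℕ) : ℝ) ≤ P.L := by exact_mod_cast P.two_pow_21_mul_Sdepth_le_L
  push_cast at h4
  have hn : (0 : ℝ) ≤ n := by positivity
  have hprod : ((n : ℝ) + 1) * (2097152 * (P.Sdepth + 3)) ≤ ((n : ℝ) + 1) * P.L :=
    mul_le_mul_of_nonneg_left h4 (by positivity)
  have e : 16 * (n + 1) * (P.L : ℝ) * (1 + 1 / (n + 2) ^ 3 + 1 / 2 ^ 25) =
      16 * (n + 1) * P.L / (n + 2) ^ 3 + 16 * (n + 1) * P.L + (n + 1) * P.L / 2 ^ 21 := by ring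
  rw [e]
  linarith

/-- `T₀ + n − 1 ≤ Mord 0 0 + (n+1)(Ŝ+1) + n` (v1, ℕ). [folklore] -/
theorem T01_add_le : P.Mord 0 0 + P.Sdepth * (n + 1) + n + n - 1 ≤ P.Mord 0 0 + (n + 1) * (P.Sdepth + 1) + n := by
  have : P.Sdepth * (n + 1) + n - 1 ≤ (n + 1) * (P.Sdepth + 1) := by
    have h : (n + 1) * (P.Sdepth + 1) = P.Sdepth * (n + 1) + (n + 1) := by ring
    omega
  omega

end PadicG3Par

end Summit.ABC.StewartYu

end
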